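import Summits.CriticalPhenomena.PercolationContinuityZ3.Theorems.PercAnnulusCrossingIICIntrinsicVolumeExponent
import Summits.CriticalPhenomena.PercolationContinuityZ3.Theorems.PercAnnulusCrossingIICVolumeExponentBounds
import HarnessLib

/-!
# The exponents of Kesten's IIC — master statements (lane RSW3, p1 gen 14)

builds on p205010 (kernel theorem, internal audit signed; external expert review pending) — through `θ(p_c) = 0` in the imported gen 14 files;
the `ℤ²` statement is unconditional.

Seat `prim-rsw3-p1` (gen 14); memo `run/shared/lean/prim/rsw3/P1-QM.md` §27.  Helper file for the crux `stmt-CriticalPhenomena-4575`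
chain; no definitions, no sorries.  Conjunctions of gen 14's exponent theorems, for citation:

* **`iicMeasure_exponents_master_criticalProbI`** — at `p_c(ℤ^d)`, `d ≥ 2`, under (A2)□ at aspect `(s,L)`, `2 ≤ s ≤ L`, for every measure `ν` with
  Kesten's IIC limit property there are DETERMINISTIC constants `α⁻, α⁺` (chemical distance to `Λ(n)ᶜ`), `β⁻, β⁺` (volume in `Λ(n)`), `γ⁻, γ⁺`
  (intrinsic-ball volume) in `[0,∞]` with `1 ≤ α⁻ ≤ α⁺ ≤ β⁺ ≤ d`, `α⁻ ≤ β⁻ ≤ β⁺`, `1 ≤ γ⁻ ≤ γ⁺ ≤ β⁺`, and `ν`-a.s. the six `liminf/limsup log(·)/log(n+2)`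
  equal them;
* **`iicMeasure_exponents_master_of_tight_criticalProbI`** — adding tightness of the annulus crossing-cluster count at one aspect: moreover `(d+1)/2 ≤ β⁺`;
* **`iicMeasure_exponents_master3_Z2`** — Kesten's planar IIC, unconditionally: all of the above with `3/2 ≤ β⁺ ≤ 2 - 2^{-158} < 2`.

References: H. Kesten, PTRF 73 (1986), Thm. (3), (8); G. Kozma, A. Nachmias (2009, 2011); H.-O. Georgii (2011), Prop. 7.9.
-/

noncomputable section

namespace Summit.CriticalPhenomena.PercolationContinuityZ3.Theorems.Crossing

open MeasureTheory Filter Topology Literature.Probability.Percolation Literature.Probability.LatticeModels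
open Literature.Probability.Percolation.DCT16 Literature.Probability.Percolation.DKT20
open Summit.CriticalPhenomena.PercolationContinuityZ3.Theorems.SurfaceTension
open scoped Literature.Probability.Percolation ENNReal symmDiff

variable {d : ℕ}

open Classical in
/-- **THE EXPONENTS OF KESTEN'S IIC AT `p_c(ℤ^d)` — MASTER STATEMENT** (`d ≥ 2`, (A2)□ at aspect `(s,L)`, `2 ≤ s ≤ L`): deterministic
`α^±` (chemical distance to `Λ(n)ᶜ`), `β^±` (volume), `γ^±` (intrinsic-ball volume) with `1 ≤ α⁻ ≤ α⁺ ≤ β⁺ ≤ d`, `α⁻ ≤ β⁻ ≤ β⁺`, `1 ≤ γ⁻ ≤ γ⁺ ≤ β⁺`,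
realised `ν`-a.s. as `liminf/limsup` of `log(·)/log(n+2)`. [cite: Kesten1986, Thm. (3), (8)] [cite: BasuSapozhnikov2017ECP, Thm. 1.1] [cite: Georgii2011, Prop. 7.9] -/
theorem iicMeasure_exponents_master_criticalProbI (hd : 2 ≤ d) {s L : ℕ} (hs : 2 ≤ s) (hsL : s ≤ L) {ϰ : ℝ} (hϰ : 0 < ϰ)
    (hA2 : SetToSetQuasiMultAspectAt d (criticalProbI d) s L ϰ)
    {ν : Measure (BondConfig (Site d))} [IsProbabilityMeasure ν]
    (hν : ∀ (F : Finset (Sym2 (Site d))) (E : Set (BondConfig (Site d))), MeasurableSet E → DeterminedBy E ↑F →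
      Tendsto (fun n : ℕ => (bondPercolation (zdGraph d) (criticalProbI d)).real (E ∩ siteToBoundary d n) /
        oneArmProb d (criticalProbI d) n) atTop (𝓝 (ν.real E))) :
    ∃ αl αu βl βu γl γu : ℝ≥0∞, (1 ≤ αl ∧ αl ≤ αu ∧ αu ≤ βu ∧ βu ≤ d ∧ αl ≤ βl ∧ βl ≤ βu ∧ 1 ≤ γl ∧ γl ≤ γu ∧ γu ≤ βu) ∧
      ∀ᵐ ω ∂ν,
      liminf (fun n => ENNReal.ofReal
        (Real.log (((⨅ v : {v : Site d // v ∉ box d n}, (openGraph ω).edist (0 : Site d) v.1).toNat : ℕ) : ℝ) /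
          Real.log ((n : ℝ) + 2))) atTop = αl ∧
      limsup (fun n => ENNReal.ofReal
        (Real.log (((⨅ v : {v : Site d // v ∉ box d n}, (openGraph ω).edist (0 : Site d) v.1).toNat : ℕ) : ℝ) /
          Real.log ((n : ℝ) + 2))) atTop = αu ∧
      liminf (fun n => ENNReal.ofReal
        (Real.log ((((box d n).filter fun z => ω ∈ (openConn (0 : Site d) z : Set (BondConfig (Site d)))).card : ℕ) : ℝ) /
          Real.log ((n : ℝ) + 2))) atTop = βl ∧
      limsup (fun n => ENNReal.ofReal
        (Real.log ((((box d n).filter fun z => ω ∈ (openConn (0 : Site d) z : Set (BondConfig (Site d)))).card : ℕ) : ℝ) /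
          Real.log ((n : ℝ) + 2))) atTop = βu ∧
      liminf (fun r => ENNReal.ofReal (Real.log
        ((Set.ncard {z : Site d | z ∈ box d r ∧ (openGraph ω).edist (0 : Site d) z ≤ (r : ℕ)} : ℕ) : ℝ) /
          Real.log ((r : ℝ) + 2))) atTop = γl ∧
      limsup (fun r => ENNReal.ofReal (Real.log
        ((Set.ncard {z : Site d | z ∈ box d r ∧ (openGraph ω).edist (0 : Site d) z ≤ (r : ℕ)} : ℕ) : ℝ) /
          Real.log ((r : ℝ) + 2))) atTop = γu := by
  classical
  obtain ⟨αl, αu, βl, βu, h1, h2, h3, h4, h5, h6, hvol⟩ := iicMeasure_volume_exponents_criticalProbI hd hs hsL hϰ hA2 hν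
  obtain ⟨γl, γu, βu', hγ1, hγ2, hγ3, -, hint⟩ := iicMeasure_intrinsic_exponents_criticalProbI hd hs hsL hϰ hA2 hν
  obtain ⟨ω, hω1, hω2⟩ := (hvol.and hint).exists
  have hβ : βu' = βu := by rw [← hω2.2.2, hω1.2.2.2]
  subst hβ
  refine ⟨αl, αu, βl, βu', γl, γu, ⟨h1, h2, h4, h6, h3, h5, hγ1, hγ2, hγ3⟩, ?_⟩
  filter_upwards [hvol, hint] with ω' hv hi
  exact ⟨hv.1, hv.2.1, hv.2.2.1, hv.2.2.2, hi.1, hi.2.1⟩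

open Classical in
/-- **Master statement with count tightness** (`p_c(ℤ^d)`, `d ≥ 2`, (A2)□ `2 ≤ s ≤ L`, tightness of `N(n, C₀n)` at one `C₀ ≥ 2`): as in
`iicMeasure_exponents_master_criticalProbI`, and moreover `(d+1)/2 ≤ β⁺`. [cite: Kesten1986, Thm. (8)] [cite: KozmaNachmias2011, Lemma 3.1] -/
theorem iicMeasure_exponents_master_of_tight_criticalProbI (hd : 2 ≤ d) {s L : ℕ} (hs : 2 ≤ s) (hsL : s ≤ L) {ϰ : ℝ} (hϰ : 0 < ϰ)
    (hA2 : SetToSetQuasiMultAspectAt d (criticalProbI d) s L ϰ) {C₀ : ℕ} (hC₀ : 2 ≤ C₀)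
    (hT : ∀ ε : ℝ, 0 < ε → ∃ k : ℕ, ∀ n : ℕ, 1 ≤ n →
      (bondPercolation (zdGraph d) (criticalProbI d)).real {ω | (k : ℕ∞) < annulusClusterCount d n (C₀ * n) ω} ≤ ε)
    {ν : Measure (BondConfig (Site d))} [IsProbabilityMeasure ν]
    (hν : ∀ (F : Finset (Sym2 (Site d))) (E : Set (BondConfig (Site d))), MeasurableSet E → DeterminedBy E ↑F →
      Tendsto (fun n : ℕ => (bondPercolation (zdGraph d) (criticalProbI d)).real (E ∩ siteToBoundary d n) /
        oneArmProb d (criticalProbI d) n) atTop (𝓝 (ν.real E))) :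
    ∃ αl αu βl βu γl γu : ℝ≥0∞, (1 ≤ αl ∧ αl ≤ αu ∧ αu ≤ βu ∧ βu ≤ d ∧ αl ≤ βl ∧ βl ≤ βu ∧ 1 ≤ γl ∧ γl ≤ γu ∧ γu ≤ βu ∧
        ENNReal.ofReal (((d : ℝ) + 1) / 2) ≤ βu) ∧
      ∀ᵐ ω ∂ν,
      liminf (fun n => ENNReal.ofReal
        (Real.log (((⨅ v : {v : Site d // v ∉ box d n}, (openGraph ω).edist (0 : Site d) v.1).toNat : ℕ) : ℝ) /
          Real.log ((n : ℝ) + 2))) atTop = αl ∧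
      limsup (fun n => ENNReal.ofReal
        (Real.log (((⨅ v : {v : Site d // v ∉ box d n}, (openGraph ω).edist (0 : Site d) v.1).toNat : ℕ) : ℝ) /
          Real.log ((n : ℝ) + 2))) atTop = αu ∧
      liminf (fun n => ENNReal.ofReal
        (Real.log ((((box d n).filter fun z => ω ∈ (openConn (0 : Site d) z : Set (BondConfig (Site d)))).card : ℕ) : ℝ) /
          Real.log ((n : ℝ) + 2))) atTop = βl ∧
      limsup (fun n => ENNReal.ofReal
        (Real.log ((((box d n).filter fun z => ω ∈ (openConn (0 : Site d) z : Set (BondConfig (Site d)))).card : ℕ) : ℝ) /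
          Real.log ((n : ℝ) + 2))) atTop = βu ∧
      liminf (fun r => ENNReal.ofReal (Real.log
        ((Set.ncard {z : Site d | z ∈ box d r ∧ (openGraph ω).edist (0 : Site d) z ≤ (r : ℕ)} : ℕ) : ℝ) /
          Real.log ((r : ℝ) + 2))) atTop = γl ∧
      limsup (fun r => ENNReal.ofReal (Real.log
        ((Set.ncard {z : Site d | z ∈ box d r ∧ (openGraph ω).edist (0 : Site d) z ≤ (r : ℕ)} : ℕ) : ℝ) /
          Real.log ((r : ℝ) + 2))) atTop = γu := by
  classical
  obtain ⟨αl, αu, βl, βu, γl, γu, hrel, hae⟩ := iicMeasure_exponents_master_criticalProbI hd hs hsL hϰ hA2 hν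
  obtain ⟨βu', hlow, hβ'⟩ := iicMeasure_exists_ae_limsup_volume_exponent_ge_of_tight hd hs hsL hϰ hA2 hC₀ hT hν
  obtain ⟨ω, hω1, hω2⟩ := (hae.and hβ').exists
  have hβ : βu' = βu := by rw [← hω2, hω1.2.2.2.1]
  subst hβ
  exact ⟨αl, αu, βl, βu', γl, γu, ⟨hrel.1, hrel.2.1, hrel.2.2.1, hrel.2.2.2.1, hrel.2.2.2.2.1, hrel.2.2.2.2.2.1,
    hrel.2.2.2.2.2.2.1, hrel.2.2.2.2.2.2.2.1, hrel.2.2.2.2.2.2.2.2, hlow⟩, hae⟩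

open Classical in
/-- **THE EXPONENTS OF KESTEN'S PLANAR IIC — MASTER STATEMENT WITH THE INTRINSIC EXPONENTS, UNCONDITIONAL**: deterministic
`1 ≤ α⁻ ≤ α⁺ ≤ β⁺`, `α⁻ ≤ β⁻ ≤ β⁺`, `1 ≤ γ⁻ ≤ γ⁺ ≤ β⁺`, `3/2 ≤ β⁺ ≤ 2 - 2^{-158} < 2`, realised `ν`-a.s., for every measure `ν` with Kesten's
IIC limit property at `p_c(ℤ²) = 1/2`. [cite: Kesten1986, Thm. (3), (8)] [cite: BollobasRiordan2006, Ch. 3, Thm. 6] [cite: Georgii2011, Prop. 7.9] -/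
theorem iicMeasure_exponents_master3_Z2 {ν : Measure (BondConfig (Site 2))} [IsProbabilityMeasure ν]
    (hν : ∀ (F : Finset (Sym2 (Site 2))) (E : Set (BondConfig (Site 2))), MeasurableSet E → DeterminedBy E ↑F →
      Tendsto (fun n : ℕ => (bondPercolation (zdGraph 2) (criticalProbI 2)).real (E ∩ siteToBoundary 2 n) /
        oneArmProb 2 (criticalProbI 2) n) atTop (𝓝 (ν.real E))) :
    ∃ αl αu βl βu γl γu : ℝ≥0∞, (1 ≤ αl ∧ αl ≤ αu ∧ αu ≤ βu ∧ αl ≤ βl ∧ βl ≤ βu ∧ 1 ≤ γl ∧ γl ≤ γu ∧ γu ≤ βu ∧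
        ENNReal.ofReal (3 / 2) ≤ βu ∧ βu ≤ ENNReal.ofReal (2 - (2 : ℝ)⁻¹ ^ 158) ∧ βu < 2) ∧
      ∀ᵐ ω ∂ν,
      liminf (fun n => ENNReal.ofReal
        (Real.log (((⨅ v : {v : Site 2 // v ∉ box 2 n}, (openGraph ω).edist (0 : Site 2) v.1).toNat : ℕ) : ℝ) /
          Real.log ((n : ℝ) + 2))) atTop = αl ∧
      limsup (fun n => ENNReal.ofReal
        (Real.log (((⨅ v : {v : Site 2 // v ∉ box 2 n}, (openGraph ω).edist (0 : Site 2) v.1).toNat : ℕ) : ℝ) /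
          Real.log ((n : ℝ) + 2))) atTop = αu ∧
      liminf (fun n => ENNReal.ofReal
        (Real.log ((((box 2 n).filter fun z => ω ∈ (openConn (0 : Site 2) z : Set (BondConfig (Site 2)))).card : ℕ) : ℝ) /
          Real.log ((n : ℝ) + 2))) atTop = βl ∧
      limsup (fun n => ENNReal.ofReal
        (Real.log ((((box 2 n).filter fun z => ω ∈ (openConn (0 : Site 2) z : Set (BondConfig (Site 2)))).card : ℕ) : ℝ) /
          Real.log ((n : ℝ) + 2))) atTop = βu ∧
      liminf (fun r => ENNReal.ofReal (Real.log
        ((Set.ncard {z : Site 2 | z ∈ box 2 r ∧ (openGraph ω).edist (0 : Site 2) z ≤ (r : ℕ)} : ℕ) : ℝ) /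
          Real.log ((r : ℝ) + 2))) atTop = γl ∧
      limsup (fun r => ENNReal.ofReal (Real.log
        ((Set.ncard {z : Site 2 | z ∈ box 2 r ∧ (openGraph ω).edist (0 : Site 2) z ≤ (r : ℕ)} : ℕ) : ℝ) /
          Real.log ((r : ℝ) + 2))) atTop = γu := by
  classical
  obtain ⟨ϰ, hϰ, hA2⟩ := exists_setToSetQuasiMultAspectAt_two_of_criticalProbI_le
  obtain ⟨αl, αu, βl, βu, γl, γu, hrel, hae⟩ :=
    iicMeasure_exponents_master_criticalProbI (d := 2) le_rfl (by norm_num) (by norm_num) hϰ (hA2 _ le_rfl) hν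
  obtain ⟨βu', hlow, hup, hlt, hβ'⟩ := iicMeasure_volume_exponent_bounds_Z2 hν
  obtain ⟨ω, hω1, hω2⟩ := (hae.and hβ').exists
  have hβ : βu' = βu := by rw [← hω2, hω1.2.2.2.1]
  subst hβ
  exact ⟨αl, αu, βl, βu', γl, γu, ⟨hrel.1, hrel.2.1, hrel.2.2.1, hrel.2.2.2.2.1, hrel.2.2.2.2.2.1,
    hrel.2.2.2.2.2.2.1, hrel.2.2.2.2.2.2.2.1, hrel.2.2.2.2.2.2.2.2, hlow, hup, hlt⟩, hae⟩

end Summit.CriticalPhenomena.PercolationContinuityZ3.Theorems.Crossing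

end
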